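import Literature.NumberTheory.LFunctions.RudnickSarnakNArch
import Literature.NumberTheory.LFunctions.RudnickSarnak
import Mathlib.MeasureTheory.Integral.DominatedConvergence
import Mathlib.Analysis.Normed.Group.FunctionSeries
import HarnessLib

/-!
# Rudnick–Sarnak `n`-level correlations for `ζ`, IX: the windowed correlation sum as a slice integral

Sibling file of `Literature/NumberTheory/LFunctions/RudnickSarnak.lean` (toward
`Literature.NumberTheory.LFunctions.rudnick_sarnak_unrestricted` at every level). This is
Rudnick–Sarnak 1996, (3.11): "By Fourier expanding `f`, `C_n(f, h, T) = ∫_{ℝⁿ} Π_j {Σ_γ h_j(γ/T)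
T^{−iγξ_j}} Φ(ξ) δ(ξ_1 + ⋯ + ξ_n) dξ`", in the `t`-windowed form of this programme: for a level
`n = k + 1`, a bounded integrable `Φ` on the slice `ξ_0 = −Σ η` and `L = log T`, the sum over all
`n`-tuples of positive ordinates

  `W(T) = Σ_{m ∈ ℕⁿ} f_Φ(Lγ_m/2π) K_T(γ_m)`,  `K_T(γ) = ∫_0^T Π_j κ(t − γ_j) dt ≥ 0`
  (`RudnickSarnakN.zeroSideSum`, `RudnickSarnakN.winKer`)

equals the slice integral of the product of the windowed zero sums of the slots,

  `W(T) = ∫_0^T ∫_η Φ(ξ(η)) Π_j S⁺(−L ξ_j(η), t) dη dt`   (`RudnickSarnakN.zeroSideSum_eq_integral`),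

where `f_Φ = rsPhiTest Φ` ((3.6); the phase `e(−x·ξ)` at `x = Lγ/2π` is `Π_j e^{−iLξ_jγ_j}`,
`RudnickSarnakN.rsPhiTest_scaled`) and `S⁺ = RudnickSarnakN.zeroSumPlus`
(`RudnickSarnakNExplicit.lean`). Proof: the identity for the zero sums truncated to the first
`N₁` ordinates is finite algebra (`Finset.prod_univ_sum`) and finite Fubini; both sides converge
as `N₁ → ∞` (dominated convergence, domination by `(Σ_n κ(t − γ_n))ⁿ ≤ (C log(t+2))ⁿ`).

## References

* Z. Rudnick, P. Sarnak, *Zeros of principal `L`-functions and random matrix theory*, Duke Math.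
  J. 81 (1996), 269–322, (3.6), (3.11).
-/

noncomputable section

open Complex Filter Set MeasureTheory Finset
open scoped Real Topology

namespace Literature.NumberTheory.LFunctions

namespace RudnickSarnakN

variable {k : ℕ}

/-! ## The slice, the window, the two sides -/

/-- The point of the hyperplane `Σ ξ_j = 0` above `η ∈ ℝᵏ`: `ξ(η) = (−Σ η, η_1, …, η_k)`
(Rudnick–Sarnak 1996, (3.6): the measure `δ(ξ_1 + ⋯ + ξ_n) dξ`). [cite: RudnickSarnak1996, (3.6)] -/
def slicePt (η : Fin k → ℝ) : Fin (k + 1) → ℝ :=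
  Fin.cons (-∑ i, η i) η

/-- `Σ_j ξ_j(η) = 0`. [folklore] -/
theorem sum_slicePt (η : Fin k → ℝ) : ∑ j, slicePt η j = 0 := by
  rw [Fin.sum_univ_succ]
  simp [slicePt]

/-- The `t`-averaged window of an `n`-tuple of ordinates: `K_T(γ) = ∫_0^T Π_j κ(t − γ_j) dt`.
(The `t`-average of Montgomery 1973, §2, in place of RS's cut-offs `Π h_j(γ_j/T)`.)
[cite: RudnickSarnak1996, (3.11)] -/
def winKer (T : ℝ) (γ : Fin (k + 1) → ℝ) : ℝ :=
  ∫ t in (0 : ℝ)..T, ∏ j, ker (t - γ j)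

/-- The tuple of ordinates indexed by `m ∈ ℕⁿ`. [folklore] -/
def ordTuple (m : Fin (k + 1) → ℕ) : Fin (k + 1) → ℝ :=
  fun j ↦ zetaOrdinate (m j)

/-- **The windowed `n`-level sum over all tuples of positive ordinates**:
`W(T) = Σ_{m ∈ ℕⁿ} f_Φ(Lγ_m/2π) K_T(γ_m)`, `L = log T`. (Rudnick–Sarnak 1996, (3.11): `C_n(f, h, T)`.)
[cite: RudnickSarnak1996, (3.11)] -/
def zeroSideSum (Φ : (Fin (k + 1) → ℝ) → ℂ) (T : ℝ) : ℂ :=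
  ∑' m : Fin (k + 1) → ℕ,
    rsPhiTest Φ (fun j ↦ Real.log T * zetaOrdinate (m j) / (2 * π)) * (winKer T (ordTuple m) : ℂ)

/-- The windowed zero sum of one slot truncated to the first `N₁` ordinates. [folklore] -/
def zeroSumPlusTrunc (N₁ : ℕ) (a t : ℝ) : ℂ :=
  ∑ n ∈ Finset.range N₁, cexp (((a * zetaOrdinate n : ℝ) : ℂ) * I) * (ker (t - zetaOrdinate n) : ℂ)

/-- The analytic side: `∫_0^T ∫_η Φ(ξ(η)) Π_j S⁺(−L ξ_j(η), t) dη dt`. [cite: RudnickSarnak1996, (3.11)] -/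
def sliceIntegral (Φ : (Fin (k + 1) → ℝ) → ℂ) (T : ℝ) : ℂ :=
  ∫ t in (0 : ℝ)..T, ∫ η : Fin k → ℝ, Φ (slicePt η) * ∏ j, zeroSumPlus (-(Real.log T * slicePt η j)) t

/-! ## Elementary facts -/

/-- `Π_j κ(t − γ_j) ≥ 0`. [folklore] -/
theorem prod_ker_nonneg (t : ℝ) (γ : Fin (k + 1) → ℝ) : 0 ≤ ∏ j, ker (t - γ j) :=
  Finset.prod_nonneg fun _ _ ↦ ker_nonneg _

/-- `t ↦ Π_j κ(t − γ_j)` is continuous. [folklore] -/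
theorem continuous_prod_ker (γ : Fin (k + 1) → ℝ) : Continuous fun t : ℝ ↦ ∏ j, ker (t - γ j) :=
  continuous_finsetProd _ fun _ _ ↦ continuous_ker.comp (continuous_id.sub continuous_const)

/-- `K_T(γ) ≥ 0` for `T ≥ 0`. [folklore] -/
theorem winKer_nonneg {T : ℝ} (hT : 0 ≤ T) (γ : Fin (k + 1) → ℝ) : 0 ≤ winKer T γ :=
  intervalIntegral.integral_nonneg hT fun t _ ↦ prod_ker_nonneg t γ

/-- **The phase of `f_Φ` at scaled ordinates**:
`f_Φ(Lγ/2π) = ∫_η Φ(ξ(η)) Π_j e^{−iLξ_j(η)γ_j} dη`. [cite: RudnickSarnak1996, (3.6)] -/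
theorem rsPhiTest_scaled (Φ : (Fin (k + 1) → ℝ) → ℂ) (L : ℝ) (γ : Fin (k + 1) → ℝ) :
    rsPhiTest Φ (fun j ↦ L * γ j / (2 * π)) =
      ∫ η : Fin k → ℝ, Φ (slicePt η) * ∏ j, cexp (((-(L * slicePt η j) * γ j : ℝ) : ℂ) * I) := by
  unfold rsPhiTest
  congr 1 with η
  congr 1
  rw [← Complex.exp_sum]
  congr 1
  have hπ : (π : ℝ) ≠ 0 := Real.pi_pos.ne'
  have hL : ∑ i : Fin k, (L * γ i.succ / (2 * π) - L * γ 0 / (2 * π)) * η i =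
      L / (2 * π) * ∑ i, η i * (γ i.succ - γ 0) := by
    rw [Finset.mul_sum]
    refine Finset.sum_congr rfl fun i _ ↦ ?_
    field_simp
  have hR : ∑ j, -(L * slicePt η j) * γ j = -L * ∑ i : Fin k, η i * (γ i.succ - γ 0) := by
    rw [Fin.sum_univ_succ]
    simp only [slicePt, Fin.cons_zero, Fin.cons_succ]
    rw [show -(L * -∑ i, η i) * γ 0 = ∑ i, L * η i * γ 0 by
        simp only [mul_neg, neg_neg, Finset.mul_sum, Finset.sum_mul],
      ← Finset.sum_add_distrib, Finset.mul_sum]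
    refine Finset.sum_congr rfl fun i _ ↦ ?_
    ring
  have e2 : ∑ x : Fin (k + 1), (((-(L * slicePt η x) * γ x : ℝ)) : ℂ) * I =
      (((-L * ∑ i : Fin k, η i * (γ i.succ - γ 0) : ℝ)) : ℂ) * I := by
    rw [← Finset.sum_mul, ← hR, Complex.ofReal_sum]
  dsimp only
  rw [hL, e2]
  push_cast
  field_simp

/-! ## The truncated identity (finite algebra) -/

/-- A product of truncated slot sums is a sum over tuples: `Π_j S_{N₁}(a_j, t) = Σ_{m ∈ [0,N₁)ⁿ} Π_j e^{ia_jγ_{m_j}} κ(t − γ_{m_j})`.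
[folklore] -/
theorem prod_zeroSumPlusTrunc (N₁ : ℕ) (a : Fin (k + 1) → ℝ) (t : ℝ) :
    ∏ j, zeroSumPlusTrunc N₁ (a j) t =
      ∑ m ∈ Fintype.piFinset (fun _ : Fin (k + 1) ↦ Finset.range N₁),
        ∏ j, (cexp (((a j * zetaOrdinate (m j) : ℝ) : ℂ) * I) * (ker (t - zetaOrdinate (m j)) : ℂ)) := by
  unfold zeroSumPlusTrunc
  rw [Finset.prod_univ_sum]

/-- Integrability of the slice integrand for one tuple (`|Φ| Π κ ≤ |Φ| κ(0)ⁿ`). [folklore] -/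
theorem integrable_slice_term {Φ : (Fin (k + 1) → ℝ) → ℂ} (hΦ : Integrable fun η : Fin k → ℝ ↦ Φ (slicePt η))
    (L : ℝ) (γ : Fin (k + 1) → ℝ) :
    Integrable fun η : Fin k → ℝ ↦ Φ (slicePt η) * ∏ j, cexp (((-(L * slicePt η j) * γ j : ℝ) : ℂ) * I) := by
  refine Integrable.mono' (g := fun η ↦ ‖Φ (slicePt η)‖) hΦ.norm (hΦ.aestronglyMeasurable.mul ?_)
    (Eventually.of_forall fun η ↦ ?_)
  · refine Continuous.aestronglyMeasurable ?_
    refine continuous_finsetProd _ fun j _ ↦ ?_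
    have : Continuous fun η : Fin k → ℝ ↦ slicePt η j := by
      unfold slicePt
      refine Fin.cases ?_ (fun i ↦ ?_) j
      · simp only [Fin.cons_zero]; fun_prop
      · simp only [Fin.cons_succ]; fun_prop
    fun_prop
  · rw [norm_mul]
    have : ‖∏ j, cexp (((-(L * slicePt η j) * γ j : ℝ) : ℂ) * I)‖ = 1 := by
      rw [norm_prod]
      exact Finset.prod_eq_one fun j _ ↦ Complex.norm_exp_ofReal_mul_I _
    rw [this, mul_one]

/-- Coordinates of the slice point are continuous in `η`. [folklore] -/
theorem continuous_slicePt_apply (j : Fin (k + 1)) : Continuous fun η : Fin k → ℝ ↦ slicePt η j := by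
  unfold slicePt
  refine Fin.cases ?_ (fun i ↦ ?_) j
  · simp only [Fin.cons_zero]; fun_prop
  · simp only [Fin.cons_succ]; fun_prop

/-- **The truncated identity**: for every `N₁`,
`Σ_{m ∈ [0,N₁)ⁿ} f_Φ(Lγ_m/2π) K_T(γ_m) = ∫_0^T ∫_η Φ(ξ(η)) Π_j S_{N₁}(−Lξ_j(η), t) dη dt`.
[cite: RudnickSarnak1996, (3.11)] -/
theorem sum_trunc_eq_integral {Φ : (Fin (k + 1) → ℝ) → ℂ} (hΦ : Integrable fun η : Fin k → ℝ ↦ Φ (slicePt η))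
    (N₁ : ℕ) (T : ℝ) :
    ∑ m ∈ Fintype.piFinset (fun _ : Fin (k + 1) ↦ Finset.range N₁),
        rsPhiTest Φ (fun j ↦ Real.log T * zetaOrdinate (m j) / (2 * π)) * (winKer T (ordTuple m) : ℂ) =
      ∫ t in (0 : ℝ)..T, ∫ η : Fin k → ℝ,
        Φ (slicePt η) * ∏ j, zeroSumPlusTrunc N₁ (-(Real.log T * slicePt η j)) t := by
  set L := Real.log T
  set F := Fintype.piFinset (fun _ : Fin (k + 1) ↦ Finset.range N₁) with hF
  -- each summand as a double integral
  have hterm : ∀ m : Fin (k + 1) → ℕ,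
      rsPhiTest Φ (fun j ↦ L * zetaOrdinate (m j) / (2 * π)) * (winKer T (ordTuple m) : ℂ) =
        ∫ t in (0 : ℝ)..T, ∫ η : Fin k → ℝ, Φ (slicePt η) *
          ∏ j, (cexp ((((-(L * slicePt η j)) * zetaOrdinate (m j) : ℝ) : ℂ) * I) *
            (ker (t - zetaOrdinate (m j)) : ℂ)) := by
    intro m
    rw [rsPhiTest_scaled, winKer, ← intervalIntegral.integral_ofReal, ← intervalIntegral.integral_const_mul]
    refine intervalIntegral.integral_congr fun t _ ↦ ?_
    rw [← integral_mul_const]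
    congr 1 with η
    rw [mul_assoc, Finset.prod_mul_distrib]
    push_cast
    rfl
  rw [Finset.sum_congr rfl fun m _ ↦ hterm m]
  -- exchange the finite sum with the two integrals
  have hint_inner : ∀ m ∈ F, ∀ t : ℝ, Integrable fun η : Fin k → ℝ ↦ Φ (slicePt η) *
      ∏ j, (cexp ((((-(L * slicePt η j)) * zetaOrdinate (m j) : ℝ) : ℂ) * I) * (ker (t - zetaOrdinate (m j)) : ℂ)) := by
    intro m _ t
    have h := (integrable_slice_term hΦ L (ordTuple m)).mul_const (∏ j, (ker (t - zetaOrdinate (m j)) : ℂ))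
    refine h.congr (Eventually.of_forall fun η ↦ ?_)
    simp only [ordTuple]
    rw [mul_assoc, ← Finset.prod_mul_distrib]
  have hcont : ∀ m ∈ F, Continuous fun t : ℝ ↦ ∫ η : Fin k → ℝ, Φ (slicePt η) *
      ∏ j, (cexp ((((-(L * slicePt η j)) * zetaOrdinate (m j) : ℝ) : ℂ) * I) * (ker (t - zetaOrdinate (m j)) : ℂ)) := by
    intro m _
    have e : (fun t : ℝ ↦ ∫ η : Fin k → ℝ, Φ (slicePt η) *
        ∏ j, (cexp ((((-(L * slicePt η j)) * zetaOrdinate (m j) : ℝ) : ℂ) * I) * (ker (t - zetaOrdinate (m j)) : ℂ))) =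
        fun t ↦ (∫ η : Fin k → ℝ, Φ (slicePt η) * ∏ j, cexp ((((-(L * slicePt η j)) * zetaOrdinate (m j) : ℝ) : ℂ) * I)) *
          ∏ j, (ker (t - zetaOrdinate (m j)) : ℂ) := by
      funext t
      rw [← integral_mul_const]
      congr 1 with η
      rw [mul_assoc, ← Finset.prod_mul_distrib]
    rw [e]
    refine continuous_const.mul ?_
    exact continuous_finsetProd _ fun j _ ↦ Complex.continuous_ofReal.comp (continuous_ker.comp (continuous_id.sub continuous_const))
  rw [← intervalIntegral.integral_finsetSum (fun m hm ↦ ((hcont m hm).intervalIntegrable _ _))]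
  refine intervalIntegral.integral_congr fun t _ ↦ ?_
  rw [← integral_finsetSum _ (fun m hm ↦ hint_inner m hm t)]
  congr 1 with η
  rw [← Finset.mul_sum, prod_zeroSumPlusTrunc]

/-! ## Convergence of the truncations -/

/-- The truncated slot sum converges to `S⁺`. [folklore] -/
theorem tendsto_zeroSumPlusTrunc (a t : ℝ) :
    Tendsto (fun N₁ ↦ zeroSumPlusTrunc N₁ a t) atTop (𝓝 (zeroSumPlus a t)) :=
  (summable_zeroSumPlus_term a t).hasSum.tendsto_sum_nat

/-- Uniform bound: `‖S_{N₁}(a, t)‖ ≤ Σ_n κ(t − γ_n)`. [folklore] -/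
theorem norm_zeroSumPlusTrunc_le (N₁ : ℕ) (a t : ℝ) : ‖zeroSumPlusTrunc N₁ a t‖ ≤ ∑' n : ℕ, ker (t - zetaOrdinate n) := by
  unfold zeroSumPlusTrunc
  refine (norm_sum_le _ _).trans ?_
  have e : ∀ n, ‖cexp (((a * zetaOrdinate n : ℝ) : ℂ) * I) * (ker (t - zetaOrdinate n) : ℂ)‖ = ker (t - zetaOrdinate n) := by
    intro n
    rw [norm_mul, Complex.norm_exp_ofReal_mul_I, one_mul, Complex.norm_real, Real.norm_of_nonneg (ker_nonneg _)]
  simp_rw [e]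
  exact (summable_ker_sub t).sum_le_tsum _ fun n _ ↦ ker_nonneg _

/-- The dominating function `D(t) = Σ_n κ(t − γ_n)` is continuous. [folklore] -/
theorem continuous_tsum_ker_sub : Continuous fun t : ℝ ↦ ∑' n : ℕ, ker (t - zetaOrdinate n) := by
  -- locally uniform domination on `|t| ≤ M`: `κ(t − γ) ≤ C/(1+(t−γ)²) ≤ 2C(1+M²)/(1+γ²)`
  rw [continuous_iff_continuousAt]
  intro t₀
  set M : ℝ := |t₀| + 1
  obtain ⟨C, hC0, hC⟩ := exists_ker_le
  have hcont : ContinuousOn (fun t : ℝ ↦ ∑' n : ℕ, ker (t - zetaOrdinate n)) (Icc (-M) M) := by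
    have hu : ∀ n : ℕ, ∀ t ∈ Icc (-M) M, ‖ker (t - zetaOrdinate n)‖ ≤ C * (2 * (1 + M ^ 2)) * (1 / (1 + zetaOrdinate n ^ 2)) := by
      intro n t ht
      rw [Real.norm_of_nonneg (ker_nonneg _)]
      have h1 : C / (1 + (t - zetaOrdinate n) ^ 2) ^ 2 ≤ C / (1 + (t - zetaOrdinate n) ^ 2) := by
        refine div_le_div_of_nonneg_left hC0.le (by positivity) ?_
        nlinarith [sq_nonneg (t - zetaOrdinate n)]
      have htM : |t| ≤ M := abs_le.2 ⟨ht.1, ht.2⟩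
      have ht2 : t ^ 2 ≤ M ^ 2 := by nlinarith [abs_nonneg t, sq_abs t]
      calc ker (t - zetaOrdinate n) ≤ C / (1 + (t - zetaOrdinate n) ^ 2) ^ 2 := hC _
        _ ≤ C * (1 / (1 + (t - zetaOrdinate n) ^ 2)) := by rw [mul_one_div]; exact h1
        _ ≤ C * (2 * (1 + t ^ 2) / (1 + zetaOrdinate n ^ 2)) :=
            mul_le_mul_of_nonneg_left (OrdinateDictionary.one_div_one_add_sq_sub_le t _) hC0.le
        _ ≤ C * (2 * (1 + M ^ 2) / (1 + zetaOrdinate n ^ 2)) := by gcongr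
        _ = C * (2 * (1 + M ^ 2)) * (1 / (1 + zetaOrdinate n ^ 2)) := by ring
    refine continuousOn_tsum (fun n ↦ ?_) (Montgomery.summable_one_div_one_add_zetaOrdinate_sq.mul_left _) hu
    exact (continuous_ker.comp (continuous_id.sub continuous_const)).continuousOn
  exact hcont.continuousAt (Icc_mem_nhds (by simp [M]; linarith [abs_nonneg t₀, neg_abs_le t₀]) (by simp [M]; linarith [le_abs_self t₀]))

/-- The slice integrand for the full sums is dominated and converges; hence for each `t` the inner
integrals of the truncations converge. [folklore] -/
theorem tendsto_inner_integral {Φ : (Fin (k + 1) → ℝ) → ℂ} (hΦ : Integrable fun η : Fin k → ℝ ↦ Φ (slicePt η))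
    (L t : ℝ) :
    Tendsto (fun N₁ ↦ ∫ η : Fin k → ℝ, Φ (slicePt η) * ∏ j, zeroSumPlusTrunc N₁ (-(L * slicePt η j)) t) atTop
      (𝓝 (∫ η : Fin k → ℝ, Φ (slicePt η) * ∏ j, zeroSumPlus (-(L * slicePt η j)) t)) := by
  set D : ℝ := ∑' n : ℕ, ker (t - zetaOrdinate n)
  have hD0 : 0 ≤ D := tsum_nonneg fun n ↦ ker_nonneg _
  refine tendsto_integral_filter_of_dominated_convergence (fun η ↦ ‖Φ (slicePt η)‖ * D ^ (k + 1)) ?_ ?_ ?_ ?_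
  · refine Eventually.of_forall fun N₁ ↦ hΦ.aestronglyMeasurable.mul (Continuous.aestronglyMeasurable ?_)
    refine continuous_finsetProd _ fun j _ ↦ ?_
    unfold zeroSumPlusTrunc
    refine continuous_finsetSum _ fun n _ ↦ ?_
    have := continuous_slicePt_apply (k := k) j
    fun_prop
  · refine Eventually.of_forall fun N₁ ↦ Eventually.of_forall fun η ↦ ?_
    rw [norm_mul, norm_prod]
    refine mul_le_mul_of_nonneg_left ?_ (norm_nonneg _)
    rw [show D ^ (k + 1) = ∏ _j : Fin (k + 1), D by simp]
    exact Finset.prod_le_prod (fun j _ ↦ norm_nonneg _) fun j _ ↦ norm_zeroSumPlusTrunc_le N₁ _ t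
  · exact hΦ.norm.mul_const _
  · refine Eventually.of_forall fun η ↦ ?_
    exact (tendsto_finsetProd _ fun j _ ↦ tendsto_zeroSumPlusTrunc _ t).const_mul _

/-- The summands of `W(T)` are absolutely summable: their norms have bounded partial sums
`≤ ‖Φ∘ξ‖₁ ∫_0^T (Σ_n κ(t−γ_n))ⁿ dt`. [folklore] -/
theorem summable_zeroSideSum_term {Φ : (Fin (k + 1) → ℝ) → ℂ} (hΦ : Integrable fun η : Fin k → ℝ ↦ Φ (slicePt η))
    {T : ℝ} (hT : 0 ≤ T) :
    Summable fun m : Fin (k + 1) → ℕ ↦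
      rsPhiTest Φ (fun j ↦ Real.log T * zetaOrdinate (m j) / (2 * π)) * (winKer T (ordTuple m) : ℂ) := by
  set L := Real.log T
  set A : ℝ := ∫ η : Fin k → ℝ, ‖Φ (slicePt η)‖
  set D : ℝ → ℝ := fun t ↦ ∑' n : ℕ, ker (t - zetaOrdinate n)
  have hD0 : ∀ t, 0 ≤ D t := fun t ↦ tsum_nonneg fun n ↦ ker_nonneg _
  -- norm of the phase integral
  have hf : ∀ m : Fin (k + 1) → ℕ, ‖rsPhiTest Φ (fun j ↦ L * zetaOrdinate (m j) / (2 * π))‖ ≤ A := by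
    intro m
    rw [rsPhiTest_scaled]
    refine (norm_integral_le_integral_norm _).trans (integral_mono_of_nonneg (Eventually.of_forall fun _ ↦ norm_nonneg _)
      hΦ.norm (Eventually.of_forall fun η ↦ ?_))
    dsimp only
    rw [norm_mul, norm_prod, Finset.prod_eq_one fun j _ ↦ Complex.norm_exp_ofReal_mul_I _, mul_one]
  -- bounded partial sums of the window kernels
  have hK : ∀ s : Finset (Fin (k + 1) → ℕ), ∑ m ∈ s, winKer T (ordTuple m) ≤ ∫ t in (0 : ℝ)..T, D t ^ (k + 1) := by
    intro s
    classical
    -- enlarge `s` to a box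
    obtain ⟨N₁, hN₁⟩ : ∃ N₁ : ℕ, s ⊆ Fintype.piFinset (fun _ : Fin (k + 1) ↦ Finset.range N₁) := by
      refine ⟨s.sup (fun m ↦ Finset.univ.sup m) + 1, fun m hm ↦ ?_⟩
      rw [Fintype.mem_piFinset]
      intro j
      rw [Finset.mem_range]
      have h1 : m j ≤ Finset.univ.sup m := Finset.le_sup (f := m) (Finset.mem_univ j)
      have h2 : Finset.univ.sup m ≤ s.sup (fun m ↦ Finset.univ.sup m) := Finset.le_sup (f := fun m ↦ Finset.univ.sup m) hm
      omega
    calc ∑ m ∈ s, winKer T (ordTuple m) ≤ ∑ m ∈ Fintype.piFinset (fun _ : Fin (k + 1) ↦ Finset.range N₁), winKer T (ordTuple m) :=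
          Finset.sum_le_sum_of_subset_of_nonneg hN₁ fun m _ _ ↦ winKer_nonneg hT _
      _ = ∫ t in (0 : ℝ)..T, ∑ m ∈ Fintype.piFinset (fun _ : Fin (k + 1) ↦ Finset.range N₁), ∏ j, ker (t - ordTuple m j) := by
          rw [intervalIntegral.integral_finsetSum fun m _ ↦ (continuous_prod_ker (ordTuple m)).intervalIntegrable _ _]
          rfl
      _ = ∫ t in (0 : ℝ)..T, ∏ _j : Fin (k + 1), ∑ n ∈ Finset.range N₁, ker (t - zetaOrdinate n) := by
          refine intervalIntegral.integral_congr fun t _ ↦ ?_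
          rw [Finset.prod_univ_sum]
          rfl
      _ ≤ ∫ t in (0 : ℝ)..T, D t ^ (k + 1) := by
          refine intervalIntegral.integral_mono_on hT ?_ ?_ fun t _ ↦ ?_
          · exact (continuous_finsetProd _ fun j _ ↦ continuous_finsetSum _ fun n _ ↦
              continuous_ker.comp (continuous_id.sub continuous_const)).intervalIntegrable _ _
          · exact ((continuous_tsum_ker_sub).pow _).intervalIntegrable _ _
          · rw [Finset.prod_const, Finset.card_fin]
            exact pow_le_pow_left₀ (Finset.sum_nonneg fun n _ ↦ ker_nonneg _)
              ((summable_ker_sub t).sum_le_tsum _ fun n _ ↦ ker_nonneg _) _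
  have hA0 : 0 ≤ A := integral_nonneg fun _ ↦ norm_nonneg _
  refine Summable.of_norm_bounded (g := fun m ↦ A * winKer T (ordTuple m)) ?_ fun m ↦ ?_
  · refine (summable_of_sum_le (fun m ↦ winKer_nonneg hT _) hK).mul_left A
  · rw [norm_mul, Complex.norm_real, Real.norm_of_nonneg (winKer_nonneg hT _)]
    exact mul_le_mul_of_nonneg_right (hf m) (winKer_nonneg hT _)

/-- **The windowed correlation sum is the slice integral of the product of the windowed zero sums**
(Rudnick–Sarnak 1996, (3.11), `t`-windowed): for `T ≥ 0` and `Φ` integrable on the slice,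
`Σ_{m ∈ ℕⁿ} f_Φ(Lγ_m/2π) K_T(γ_m) = ∫_0^T ∫_η Φ(ξ(η)) Π_j S⁺(−Lξ_j(η), t) dη dt`.
[cite: RudnickSarnak1996, (3.11)] -/
theorem zeroSideSum_eq_sliceIntegral {Φ : (Fin (k + 1) → ℝ) → ℂ} (hΦ : Integrable fun η : Fin k → ℝ ↦ Φ (slicePt η))
    {T : ℝ} (hT : 0 ≤ T) : zeroSideSum Φ T = sliceIntegral Φ T := by
  set L := Real.log T
  -- the truncations along `N₁ ↦ [0, N₁)ⁿ`
  set box : ℕ → Finset (Fin (k + 1) → ℕ) := fun N₁ ↦ Fintype.piFinset (fun _ : Fin (k + 1) ↦ Finset.range N₁)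
  have hbox : Tendsto box atTop atTop := by
    refine tendsto_atTop_finset_of_monotone (fun a b hab ↦ Fintype.piFinset_subset _ _ fun _ ↦ Finset.range_subset_range.2 hab)
      fun m ↦ ⟨Finset.univ.sup m + 1, ?_⟩
    rw [Fintype.mem_piFinset]
    intro j
    rw [Finset.mem_range]
    exact Nat.lt_succ_of_le (Finset.le_sup (f := m) (Finset.mem_univ j))
  -- left side converges to the `tsum`
  have h1 : Tendsto (fun N₁ ↦ ∑ m ∈ box N₁,
      rsPhiTest Φ (fun j ↦ L * zetaOrdinate (m j) / (2 * π)) * (winKer T (ordTuple m) : ℂ)) atTop (𝓝 (zeroSideSum Φ T)) :=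
    (summable_zeroSideSum_term hΦ hT).hasSum.comp hbox
  -- and equals the truncated slice integrals, which converge to the full one
  have h2 : Tendsto (fun N₁ ↦ ∫ t in (0 : ℝ)..T, ∫ η : Fin k → ℝ,
      Φ (slicePt η) * ∏ j, zeroSumPlusTrunc N₁ (-(L * slicePt η j)) t) atTop (𝓝 (sliceIntegral Φ T)) := by
    set A : ℝ := ∫ η : Fin k → ℝ, ‖Φ (slicePt η)‖
    set D : ℝ → ℝ := fun t ↦ ∑' n : ℕ, ker (t - zetaOrdinate n)
    refine intervalIntegral.tendsto_integral_filter_of_dominated_convergence (fun t ↦ A * D t ^ (k + 1)) ?_ ?_ ?_ ?_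
    · refine Eventually.of_forall fun N₁ ↦ Continuous.aestronglyMeasurable ?_
      -- the truncated inner integral is a finite sum of continuous functions of `t`
      have e := sum_trunc_eq_integral hΦ N₁ T
      have : (fun t : ℝ ↦ ∫ η : Fin k → ℝ, Φ (slicePt η) * ∏ j, zeroSumPlusTrunc N₁ (-(L * slicePt η j)) t) =
          fun t ↦ ∑ m ∈ box N₁, (∫ η : Fin k → ℝ, Φ (slicePt η) *
            ∏ j, cexp ((((-(L * slicePt η j)) * zetaOrdinate (m j) : ℝ) : ℂ) * I)) * ∏ j, (ker (t - zetaOrdinate (m j)) : ℂ) := by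
        funext t
        rw [Finset.sum_congr rfl fun m _ ↦ (integral_mul_const _ _).symm, ← integral_finsetSum]
        · congr 1 with η
          rw [prod_zeroSumPlusTrunc, Finset.mul_sum]
          refine Finset.sum_congr rfl fun m _ ↦ ?_
          rw [Finset.prod_mul_distrib, ← mul_assoc]
        · intro m _
          exact (integrable_slice_term hΦ L (ordTuple m)).mul_const _
      rw [this]
      refine continuous_finsetSum _ fun m _ ↦ continuous_const.mul ?_
      exact continuous_finsetProd _ fun j _ ↦ Complex.continuous_ofReal.comp (continuous_ker.comp (continuous_id.sub continuous_const))
    · refine Eventually.of_forall fun N₁ ↦ Eventually.of_forall fun t _ ↦ ?_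
      refine (norm_integral_le_integral_norm _).trans ?_
      have hD0 : 0 ≤ D t := tsum_nonneg fun n ↦ ker_nonneg _
      calc ∫ η : Fin k → ℝ, ‖Φ (slicePt η) * ∏ j, zeroSumPlusTrunc N₁ (-(L * slicePt η j)) t‖
          ≤ ∫ η : Fin k → ℝ, ‖Φ (slicePt η)‖ * D t ^ (k + 1) := by
            refine integral_mono_of_nonneg (Eventually.of_forall fun _ ↦ norm_nonneg _) (hΦ.norm.mul_const _)
              (Eventually.of_forall fun η ↦ ?_)
            dsimp only
            rw [norm_mul, norm_prod]
            refine mul_le_mul_of_nonneg_left ?_ (norm_nonneg _)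
            rw [show D t ^ (k + 1) = ∏ _j : Fin (k + 1), D t by simp]
            exact Finset.prod_le_prod (fun j _ ↦ norm_nonneg _) fun j _ ↦ norm_zeroSumPlusTrunc_le N₁ _ t
        _ = A * D t ^ (k + 1) := by rw [integral_mul_const]
    · exact (continuous_const.mul (continuous_tsum_ker_sub.pow _)).intervalIntegrable _ _
    · exact Eventually.of_forall fun t _ ↦ tendsto_inner_integral hΦ L t
  have h3 : (fun N₁ ↦ ∑ m ∈ box N₁,
      rsPhiTest Φ (fun j ↦ L * zetaOrdinate (m j) / (2 * π)) * (winKer T (ordTuple m) : ℂ)) =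
      fun N₁ ↦ ∫ t in (0 : ℝ)..T, ∫ η : Fin k → ℝ, Φ (slicePt η) * ∏ j, zeroSumPlusTrunc N₁ (-(L * slicePt η j)) t :=
    funext fun N₁ ↦ sum_trunc_eq_integral hΦ N₁ T
  rw [h3] at h1
  exact tendsto_nhds_unique h1 h2

end RudnickSarnakN

end Literature.NumberTheory.LFunctions

end
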